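import Literature.Geometry.Kaehler.ComplexTorusTranscendentalLatticeProductProjection
import Literature.Geometry.Kaehler.ComplexTorusCorrespondenceTranspose
import HarnessLib

/-!
# The transcendental lattice in every degree on a product torus, BOTH factors: the swap `X₂ × X₁ ⥲ X₁ × X₂` transports the lattices,
# `p₁^* T(X₁) ⊆ T(X₁ × X₂) ⊇ p₂^* T(X₂)`, `ι₁^* T(X₁ × X₂) ⊆ T(X₁)`, `p_{1*} T(X₁ × X₂) ⊆ T(X₁)`, and
# `p₁^* T^l(X₁) ⊕ p₂^* T^l(X₂) ↪ T^l(X₁ × X₂)`: `rk T^l(X₁) + rk T^l(X₂) ≤ rk T^l(X₁ × X₂)` (`l ≠ 0`)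

Layer `Literature/Geometry/Kaehler`, namespace `Literature.Geometry.Kaehler.ComplexTorus`; lane `lit-hodgefound` (Track 2
foundations library), seat p09, generation 33, row g33-#2. THEOREMS ONLY (0 definitions); no named fact, net debt 0. Sequel of g33-#1
(`ComplexTorusTranscendentalLatticeProductProjection`: the second factor — `p₂^*`, `p_{2*} = pushforwardFst`, `ι₂^*` — for the degree-`l`
transcendental lattices `T^l_{k,p} = Hˡ(−, ℤ) ∩ ⋂_{s ∈ Hdg^{k,p}(−, ℤ)} ker ⟨s, ·⟩` of g31-#11, written out as there). Here the FIRST factor is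
reached through the exchange isomorphism `s : X₂ × X₁ ⥲ X₁ × X₂`, `s(w, v) = (v, w)` (`ContinuousLinearEquiv.prodComm ℝ E₂ E₁`; Lange §6.2.2
p. 304 "`ᵗZ := s^*Z`"; the tree's `ComplexTorusCorrespondenceTranspose`: `comp_prodComm_mem_integralForms`, `torusIntegral_comp_prodComm`):
`p₁ = p₂′ ∘ s⁻¹`, `ι₁ = s ∘ ι₂′`, so `p₁^* t = s_* p₂′^* t`, `ι₁^* x = ι₂′^* s^* x` DEFINITIONALLY on invariant forms, and g33-#1 applies to
`X₂ × X₁`. Voisin §7.3.2 (PDF pp. 149–151): pull-backs and Gysin maps of holomorphic maps are morphisms of Hodge structures with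
"`(φ_*α, β)_Y = (α, φ^*β)_X`", so they respect `Hdg(−, ℤ)` and its annihilators.

* §1 THE SWAP: `s^* Λ^{p,q}(X₁ × X₂) ⊆ Λ^{p,q}(X₂ × X₁)` (`s` is `ℂ`-linear), `s^* Hdg^{k,p}(X₁ × X₂, ℤ) ⊆ Hdg^{k,p}(X₂ × X₁, ℤ)`,
  `sign(e′) ⟨s^*γ, s^*δ⟩_{e′} = sign(e) ⟨γ, δ⟩_e` (`∫_{X₂ × X₁} s^*θ = ∫_{X₁ × X₂} θ`), and **`x ∈ T^b_{a,p}(X₁ × X₂) ⟺ s^*x ∈ T^b_{a,p}(X₂ × X₁)`**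
  for ANY enumerations `e`, `e′` of the two lattice bases.
* §2 FREE-INDEX forms of g33-#1 (`K = N₁ + k`, `P = g₁ + p` as hypotheses, for use with both factors at once):
  `p₂^* T^l_{k,p}(X₂) ⊆ T^l_{K,P}(X₁ × X₂)`, `ι₂^* T^l_{K,P}(X₁ × X₂) ⊆ T^l_{k,p}(X₂)`.
* §3 THE FIRST FACTOR (`K = N₂ + k`, `P = g₂ + p`): **`p₁^* T^l_{k,p}(X₁) ⊆ T^l_{K,P}(X₁ × X₂)`**, **`ι₁^* T^l_{K,P}(X₁ × X₂) ⊆ T^l_{k,p}(X₁)`**,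
  **`p_{1*} T^{N₂+l}_{k,p}(X₁ × X₂) ⊆ T^l_{k,p}(X₁)`** with `p_{1*} := p₂′_* ∘ s^*` (`pushforwardFst Φ₂ Φ₁ e₂ (x ∘ s)`), `ι₁^* p₁^* = id`,
  `rk T^l_{k,p}(X₁) ≤ rk T^l_{K,P}(X₁ × X₂)`.
* §4 BOTH FACTORS, `l ≠ 0`: `(t₁, t₂) ↦ p₁^*t₁ + p₂^*t₂` is an injective `ℤ`-linear map `T^l_{k₁,p₁}(X₁) × T^l_{k₂,p₂}(X₂) → T^l_{K,P}(X₁ × X₂)`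
  whenever `N₂ + k₁ = K = N₁ + k₂`, `g₂ + p₁ = P = g₁ + p₂` (the `(l,0) ⊕ (0,l)` Künneth part, g31-#4 `comp_fst_add_comp_snd_injective`), hence
  **`rk_ℤ T^l_{k₁,p₁}(X₁) + rk_ℤ T^l_{k₂,p₂}(X₂) ≤ rk_ℤ T^l_{K,P}(X₁ × X₂)`** (e.g. `l = 2`, `dim Xᵢ = 2`: `rk T(X₁ × X₂) ≥ rk T(X₁) + rk T(X₂)` for the
  transcendental lattices of two complex `2`-tori inside that of their product fourfold).

## FAIL-DUP disclosure

Consumed BY NAME: g33-#1 (`comp_snd_mem_integralHodgeAnnihilator`, `compContinuousLinearMap_inr_mem_integralHodgeAnnihilator`,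
`pushforwardFst_mem_integralHodgeAnnihilator`, `exists_intLinearMap_integralHodgeAnnihilator_comp_snd`), A4-51's swap lemmas
(`comp_prodComm_mem_integralForms`, `torusIntegral_comp_prodComm`), g31-#4 (`comp_fst_mem_integralForms`, `compContinuousLinearMap_fst_inl`,
`comp_fst_add_comp_snd_injective`), g31-#12 (`moduleFinite_integralHodgeAnnihilator`). The tree's `compContinuousLinearMap_prodComm_mem_hodgeClasses`
(`ComplexTorusDivisorClassesPushforward`, rational, degree `2q`) and `realRep_prodComm` (`ComplexTorusGraphClassesLefschetz`) are the `B`-level /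
matrix-level siblings of §1; the integral any-degree statement here is proved directly from the `ℂ`-linearity of `s` (no heavy import).

## References

* [cite: VoisinHodgeI2002, §7.3.2 (PDF pp. 149–151: `φ^*`, `φ_*` morphisms of Hodge structures; Lemma 7.28; "`(φ_*α, β)_Y = (α, φ^*β)_X`"); §11.3.3 Thm. 11.38 (Künneth)]
* [cite: Lange2023AbelianVarietiesComplex, §6.2.2 p. 304 (the exchange morphism `s`, `ᵗZ := s^*Z`); §6.2.4 (6.10) p. 310; §7.2.2]
* [cite: Arapura2012, §5.5.1 Lemma 5.5.1 (p. 114), §5.5.2 Exercise 5.5.5 (p. 115)]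
* [cite: Huybrechts2016K3, Ch. 3 §2.2 Def. 2.5 (PDF p. 58), §2.3 (PDF p. 59)]
* [cite: HatcherAT2002, §3.2 Thm. 3.15 (Künneth for `H^*(X × Y; ℤ)`, the cross product is injective on `Hˡ ⊗ H⁰ ⊕ H⁰ ⊗ Hˡ`)]
* [cite: ShiodaMitani1974, §3 (3.19)]
-/

noncomputable section

open Module Function
open Literature.LinearAlgebra.Alternating Literature.Analysis.Complex

namespace Literature.Geometry.Kaehler.ComplexTorus

section ProductFactors

variable {ι₁ ι₂ : Type*} [Fintype ι₁] [Fintype ι₂] [DecidableEq ι₁] [DecidableEq ι₂]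
  {E₁ E₂ : Type*} [NormedAddCommGroup E₁] [NormedSpace ℂ E₁] [NormedAddCommGroup E₂] [NormedSpace ℂ E₂]
  (Φ₁ : (ι₁ → ℝ) ≃L[ℝ] E₁) (Φ₂ : (ι₂ → ℝ) ≃L[ℝ] E₂) {N₁ N₂ n₁ n₂ n m k l a b : ℕ}

/-! ## §1 The swap `s : X₂ × X₁ ⥲ X₁ × X₂` transports Hodge classes, the pairing and the transcendental lattices -/

omit [Fintype ι₁] [DecidableEq ι₂] in
/-- An orientation sign is a unit of `ℂ`. [cite: VoisinHodgeI2002, §11.1.2 Cor. 11.15] -/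
private theorem orientationSign_cast_ne_zero₃₃₂ {ι E : Type*} [DecidableEq ι] [NormedAddCommGroup E] [NormedSpace ℂ E]
    (Φ : (ι → ℝ) ≃L[ℝ] E) {m : ℕ} (e : Fin m ≃ ι) : (orientationSign Φ e : ℂ) ≠ 0 := by
  rcases orientationSign_eq_or Φ e with h | h <;> rw [h] <;> norm_num

omit [Fintype ι₁] [DecidableEq ι₂] in
/-- The orientation sign does not see a re-reading of the degree. [cite: VoisinHodgeI2002, §11.1.2 Cor. 11.15] -/
private theorem orientationSign_finCongr_trans₃₃₂ {ι E : Type*} [DecidableEq ι] [NormedAddCommGroup E] [NormedSpace ℂ E]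
    (Φ : (ι → ℝ) ≃L[ℝ] E) {m m' : ℕ} (h : m = m') (e : Fin m' ≃ ι) :
    orientationSign Φ ((finCongr h).trans e) = orientationSign Φ e := by
  subst h; rfl

omit [Fintype ι₁] [Fintype ι₂] [DecidableEq ι₁] [DecidableEq ι₂] in
/-- **`s^* Λ^{p,q}(X₁ × X₂) ⊆ Λ^{p,q}(X₂ × X₁)`**: the exchange morphism is `ℂ`-linear, so its pull-back preserves types
(`IsOfTypeAt.compContinuousLinearMap`; off `p + q = m` both type submodules are zero). [cite: VoisinHodgeI2002, §7.3.2 (PDF p. 150: "the pullback of such a form is still of type (p,q)")] -/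
theorem comp_prodComm_mem_typeSubmodule {p q : ℕ} {γ : (E₁ × E₂) [⋀^Fin m]→L[ℝ] ℂ}
    (hγ : γ ∈ typeSubmodule (E₁ × E₂) m p q) :
    γ.compContinuousLinearMap (ContinuousLinearEquiv.prodComm ℝ E₂ E₁ : E₂ × E₁ →L[ℝ] E₁ × E₂) ∈
      typeSubmodule (E₂ × E₁) m p q := by
  by_cases hm : p + q = m
  · have h := (mem_typeSubmodule_iff_isOfTypeAt hm).1 hγ
    exact (h.compContinuousLinearMap (ContinuousLinearEquiv.prodComm ℝ E₂ E₁ : E₂ × E₁ →L[ℝ] E₁ × E₂)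
      (fun c w ↦ rfl)).mem_typeSubmodule
  · have h0 : γ = 0 := by
      have h := mem_typeSubmodule_iff.1 hγ
      rw [typeProjAt_of_ne hm] at h
      exact h.symm
    have hz : (0 : (E₁ × E₂) [⋀^Fin m]→L[ℝ] ℂ).compContinuousLinearMap
        (ContinuousLinearEquiv.prodComm ℝ E₂ E₁ : E₂ × E₁ →L[ℝ] E₁ × E₂) = 0 := by
      ext v; rfl
    rw [h0, hz]
    exact Submodule.zero_mem _

omit [DecidableEq ι₁] [DecidableEq ι₂] in
/-- **`s^* Hdg^{m,p}(X₁ × X₂, ℤ) ⊆ Hdg^{m,p}(X₂ × X₁, ℤ)`**: the exchange isomorphism carries integral Hodge classes to integral Hodge classes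
(integral periods: A4-51 `comp_prodComm_mem_integralForms`; type: `s` is `ℂ`-linear). [cite: VoisinHodgeI2002, §7.3.2 (PDF p. 150) and §11.3.1 Def. 11.28] [cite: Lange2023AbelianVarietiesComplex, §6.2.2 p. 304] -/
theorem comp_prodComm_mem_integralHodgeClassesIn {p : ℕ} {γ : (E₁ × E₂) [⋀^Fin m]→L[ℝ] ℂ}
    (hγ : γ ∈ integralHodgeClassesIn (prodPeriod Φ₁ Φ₂) m p) :
    γ.compContinuousLinearMap (ContinuousLinearEquiv.prodComm ℝ E₂ E₁ : E₂ × E₁ →L[ℝ] E₁ × E₂) ∈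
      integralHodgeClassesIn (prodPeriod Φ₂ Φ₁) m p :=
  (mem_integralHodgeClassesIn_iff (prodPeriod Φ₂ Φ₁)).2
    ⟨comp_prodComm_mem_integralForms Φ₁ Φ₂ ((mem_integralHodgeClassesIn_iff _).1 hγ).1,
      comp_prodComm_mem_typeSubmodule ((mem_integralHodgeClassesIn_iff _).1 hγ).2⟩

omit [Fintype ι₁] [Fintype ι₂] [DecidableEq ι₁] [DecidableEq ι₂] in
/-- `s^* s′^* = id` on forms: `(γ ∘ s′) ∘ s = γ` for the two exchange maps `s′ : X₁ × X₂ → X₂ × X₁`, `s : X₂ × X₁ → X₁ × X₂`.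
[cite: Lange2023AbelianVarietiesComplex, §6.2.2 p. 304] -/
theorem compContinuousLinearMap_prodComm_prodComm (γ : (E₂ × E₁) [⋀^Fin m]→L[ℝ] ℂ) :
    (γ.compContinuousLinearMap (ContinuousLinearEquiv.prodComm ℝ E₁ E₂ : E₁ × E₂ →L[ℝ] E₂ × E₁)).compContinuousLinearMap
        (ContinuousLinearEquiv.prodComm ℝ E₂ E₁ : E₂ × E₁ →L[ℝ] E₁ × E₂) = γ := by
  ext v; rfl

/-- **`sign(e′) · ⟨s^*γ, s^*δ⟩_{e′} = sign(e) · ⟨γ, δ⟩_e`**: the exchange isomorphism preserves the cup-product pairings up to the orientation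
signs of the chosen enumerations (`s^*(γ ∧ δ) = s^*γ ∧ s^*δ` and `∫_{X₂ × X₁} s^*θ = ∫_{X₁ × X₂} θ`, A4-51 `torusIntegral_comp_prodComm`).
[cite: Lange2023AbelianVarietiesComplex, §6.2.2 p. 304 and §6.2.4 p. 310] [cite: VoisinHodgeI2002, §7.3.2 (PDF p. 150: `φ^*(α ∪ β) = φ^*α ∪ φ^*β`)] -/
theorem orientationSign_mul_poincarePairing_comp_prodComm (e : Fin m ≃ ι₁ ⊕ ι₂) (e' : Fin m ≃ ι₂ ⊕ ι₁) (h : a + b = m)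
    (γ : (E₁ × E₂) [⋀^Fin a]→L[ℝ] ℂ) (δ : (E₁ × E₂) [⋀^Fin b]→L[ℝ] ℂ) :
    (orientationSign (prodPeriod Φ₂ Φ₁) e' : ℂ) *
        poincarePairing (prodPeriod Φ₂ Φ₁) e' h
          (γ.compContinuousLinearMap (ContinuousLinearEquiv.prodComm ℝ E₂ E₁ : E₂ × E₁ →L[ℝ] E₁ × E₂))
          (δ.compContinuousLinearMap (ContinuousLinearEquiv.prodComm ℝ E₂ E₁ : E₂ × E₁ →L[ℝ] E₁ × E₂)) =
      (orientationSign (prodPeriod Φ₁ Φ₂) e : ℂ) * poincarePairing (prodPeriod Φ₁ Φ₂) e h γ δ := by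
  have h1 : (orientationSign (prodPeriod Φ₂ Φ₁) e' : ℂ) * (orientationSign (prodPeriod Φ₂ Φ₁) e' : ℂ) = 1 := by
    exact_mod_cast orientationSign_mul_self (prodPeriod Φ₂ Φ₁) e'
  have h2 : (orientationSign (prodPeriod Φ₁ Φ₂) e : ℂ) * (orientationSign (prodPeriod Φ₁ Φ₂) e : ℂ) = 1 := by
    exact_mod_cast orientationSign_mul_self (prodPeriod Φ₁ Φ₂) e
  have hI := torusIntegral_comp_prodComm Φ₁ Φ₂ ((finCongr h).trans e) ((finCongr h).trans e') (γ.wedge δ)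
  rw [ContinuousAlternatingMap.wedge_compContinuousLinearMap] at hI
  rw [poincarePairing_eq_orientationSign_mul_torusIntegral_wedge (prodPeriod Φ₂ Φ₁) e' h,
    poincarePairing_eq_orientationSign_mul_torusIntegral_wedge (prodPeriod Φ₁ Φ₂) e h, hI,
    orientationSign_finCongr_trans₃₃₂, orientationSign_finCongr_trans₃₃₂, ← mul_assoc, ← mul_assoc, h1, h2]

/-- `⟨s^*γ, s^*δ⟩_{e′} = 0 ⟺ ⟨γ, δ⟩_e = 0`. [cite: Lange2023AbelianVarietiesComplex, §6.2.2 p. 304] -/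
theorem poincarePairing_comp_prodComm_eq_zero_iff (e : Fin m ≃ ι₁ ⊕ ι₂) (e' : Fin m ≃ ι₂ ⊕ ι₁) (h : a + b = m)
    (γ : (E₁ × E₂) [⋀^Fin a]→L[ℝ] ℂ) (δ : (E₁ × E₂) [⋀^Fin b]→L[ℝ] ℂ) :
    poincarePairing (prodPeriod Φ₂ Φ₁) e' h
          (γ.compContinuousLinearMap (ContinuousLinearEquiv.prodComm ℝ E₂ E₁ : E₂ × E₁ →L[ℝ] E₁ × E₂))
          (δ.compContinuousLinearMap (ContinuousLinearEquiv.prodComm ℝ E₂ E₁ : E₂ × E₁ →L[ℝ] E₁ × E₂)) = 0 ↔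
      poincarePairing (prodPeriod Φ₁ Φ₂) e h γ δ = 0 := by
  have hm := orientationSign_mul_poincarePairing_comp_prodComm Φ₁ Φ₂ e e' h γ δ
  constructor <;> intro h0
  · rw [h0, mul_zero] at hm
    exact (mul_eq_zero.1 hm.symm).resolve_left (orientationSign_cast_ne_zero₃₃₂ (prodPeriod Φ₁ Φ₂) e)
  · rw [h0, mul_zero] at hm
    exact (mul_eq_zero.1 hm).resolve_left (orientationSign_cast_ne_zero₃₃₂ (prodPeriod Φ₂ Φ₁) e')

/-- **`s^* T^b_{a,p}(X₁ × X₂) ⊆ T^b_{a,p}(X₂ × X₁)`**: the exchange isomorphism carries the degree-`b` transcendental lattice of `X₁ × X₂`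
(w.r.t. any enumeration `e`) into that of `X₂ × X₁` (w.r.t. any `e′`): for `S′ ∈ Hdg^{a,p}(X₂ × X₁, ℤ)`, `S′ = s^*(s′^*S′)` with
`s′^*S′ ∈ Hdg^{a,p}(X₁ × X₂, ℤ)`, and `⟨s^*(s′^*S′), s^*x⟩ = ± ⟨s′^*S′, x⟩ = 0`.
[cite: VoisinHodgeI2002, §7.3.2 (PDF pp. 150–151)] [cite: Lange2023AbelianVarietiesComplex, §6.2.2 p. 304] [cite: Huybrechts2016K3, Ch. 3 §2.2 Def. 2.5 (PDF p. 58)] -/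
theorem comp_prodComm_mem_integralHodgeAnnihilator (e : Fin m ≃ ι₁ ⊕ ι₂) (e' : Fin m ≃ ι₂ ⊕ ι₁) (h : a + b = m) (p : ℕ)
    {x : (E₁ × E₂) [⋀^Fin b]→L[ℝ] ℂ}
    (hx : x ∈ integralForms (prodPeriod Φ₁ Φ₂) b ⊓ ⨅ S : integralHodgeClassesIn (prodPeriod Φ₁ Φ₂) a p,
        (LinearMap.ker (poincarePairing (prodPeriod Φ₁ Φ₂) e h (S : (E₁ × E₂) [⋀^Fin a]→L[ℝ] ℂ))).toAddSubgroup) :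
    x.compContinuousLinearMap (ContinuousLinearEquiv.prodComm ℝ E₂ E₁ : E₂ × E₁ →L[ℝ] E₁ × E₂) ∈
      integralForms (prodPeriod Φ₂ Φ₁) b ⊓ ⨅ S : integralHodgeClassesIn (prodPeriod Φ₂ Φ₁) a p,
        (LinearMap.ker (poincarePairing (prodPeriod Φ₂ Φ₁) e' h (S : (E₂ × E₁) [⋀^Fin a]→L[ℝ] ℂ))).toAddSubgroup := by
  rw [mem_integralHodgeAnnihilator_iff] at hx ⊢
  refine ⟨comp_prodComm_mem_integralForms Φ₁ Φ₂ hx.1, fun S hS ↦ ?_⟩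
  rw [← compContinuousLinearMap_prodComm_prodComm S, poincarePairing_comp_prodComm_eq_zero_iff Φ₁ Φ₂ e e' h]
  exact hx.2 _ (comp_prodComm_mem_integralHodgeClassesIn Φ₂ Φ₁ hS)

/-- **`x ∈ T^b_{a,p}(X₁ × X₂) ⟺ s^*x ∈ T^b_{a,p}(X₂ × X₁)`** (`s^*` is an isomorphism with inverse `s′^*`).
[cite: VoisinHodgeI2002, §7.3.2 (PDF pp. 150–151)] [cite: Lange2023AbelianVarietiesComplex, §6.2.2 p. 304] -/
theorem comp_prodComm_mem_integralHodgeAnnihilator_iff (e : Fin m ≃ ι₁ ⊕ ι₂) (e' : Fin m ≃ ι₂ ⊕ ι₁) (h : a + b = m) (p : ℕ)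
    (x : (E₁ × E₂) [⋀^Fin b]→L[ℝ] ℂ) :
    x.compContinuousLinearMap (ContinuousLinearEquiv.prodComm ℝ E₂ E₁ : E₂ × E₁ →L[ℝ] E₁ × E₂) ∈
        integralForms (prodPeriod Φ₂ Φ₁) b ⊓ ⨅ S : integralHodgeClassesIn (prodPeriod Φ₂ Φ₁) a p,
          (LinearMap.ker (poincarePairing (prodPeriod Φ₂ Φ₁) e' h (S : (E₂ × E₁) [⋀^Fin a]→L[ℝ] ℂ))).toAddSubgroup ↔
      x ∈ integralForms (prodPeriod Φ₁ Φ₂) b ⊓ ⨅ S : integralHodgeClassesIn (prodPeriod Φ₁ Φ₂) a p,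
        (LinearMap.ker (poincarePairing (prodPeriod Φ₁ Φ₂) e h (S : (E₁ × E₂) [⋀^Fin a]→L[ℝ] ℂ))).toAddSubgroup := by
  refine ⟨fun hx ↦ ?_, comp_prodComm_mem_integralHodgeAnnihilator Φ₁ Φ₂ e e' h p⟩
  have h2 := comp_prodComm_mem_integralHodgeAnnihilator Φ₂ Φ₁ e' e h p hx
  have hxx : (x.compContinuousLinearMap (ContinuousLinearEquiv.prodComm ℝ E₂ E₁ : E₂ × E₁ →L[ℝ] E₁ × E₂)).compContinuousLinearMap
      (ContinuousLinearEquiv.prodComm ℝ E₁ E₂ : E₁ × E₂ →L[ℝ] E₂ × E₁) = x := by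
    ext v; rfl
  rwa [hxx] at h2

/-! ## §2 Free-index forms of g33-#1 for the second factor (`K = N₁ + k`, `P = g₁ + p`) -/

/-- **`p₂^* T^l_{k,p}(X₂) ⊆ T^l_{K,P}(X₁ × X₂)` for `K = N₁ + k`, `P = g₁ + p`** (g33-#1 `comp_snd_mem_integralHodgeAnnihilator` with the
indices of the product freed, to be matched against the first factor). [cite: VoisinHodgeI2002, §7.3.2 Lemma 7.28 and PDF p. 151] -/
theorem comp_snd_mem_integralHodgeAnnihilator_of_eq (e₁ : Fin N₁ ≃ ι₁) (e₂ : Fin n₂ ≃ ι₂) (e : Fin n ≃ ι₁ ⊕ ι₂) (h₂ : k + l = n₂)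
    {K P g₁ : ℕ} (hK : N₁ + k = K) (H : K + l = n) (hg₁ : finrank ℂ E₁ = g₁) {p : ℕ} (hP : g₁ + p = P)
    {t : E₂ [⋀^Fin l]→L[ℝ] ℂ}
    (ht : t ∈ integralForms Φ₂ l ⊓ ⨅ s : integralHodgeClassesIn Φ₂ k p,
        (LinearMap.ker (poincarePairing Φ₂ e₂ h₂ (s : E₂ [⋀^Fin k]→L[ℝ] ℂ))).toAddSubgroup) :
    t.compContinuousLinearMap (ContinuousLinearMap.snd ℝ E₁ E₂) ∈
      integralForms (prodPeriod Φ₁ Φ₂) l ⊓ ⨅ S : integralHodgeClassesIn (prodPeriod Φ₁ Φ₂) K P,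
        (LinearMap.ker (poincarePairing (prodPeriod Φ₁ Φ₂) e H (S : (E₁ × E₂) [⋀^Fin K]→L[ℝ] ℂ))).toAddSubgroup := by
  subst hK hP
  exact comp_snd_mem_integralHodgeAnnihilator Φ₁ Φ₂ e₁ e₂ e h₂ H hg₁ p ht

/-- **`ι₂^* T^l_{K,P}(X₁ × X₂) ⊆ T^l_{k,p}(X₂)` for `K = N₁ + k`, `P = g₁ + p`** (g33-#1, indices freed).
[cite: VoisinHodgeI2002, §7.3.2 (PDF pp. 150–151)] [cite: Arapura2012, §5.5.2 Exercise 5.5.5, p. 115] -/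
theorem compContinuousLinearMap_inr_mem_integralHodgeAnnihilator_of_eq (e₁ : Fin N₁ ≃ ι₁) (e₂ : Fin n₂ ≃ ι₂) (e : Fin n ≃ ι₁ ⊕ ι₂)
    (h₂ : k + l = n₂) {K P g₁ : ℕ} (hK : N₁ + k = K) (H : K + l = n) (hg₁ : finrank ℂ E₁ = g₁) {p : ℕ} (hP : g₁ + p = P)
    {x : (E₁ × E₂) [⋀^Fin l]→L[ℝ] ℂ}
    (hx : x ∈ integralForms (prodPeriod Φ₁ Φ₂) l ⊓ ⨅ S : integralHodgeClassesIn (prodPeriod Φ₁ Φ₂) K P,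
        (LinearMap.ker (poincarePairing (prodPeriod Φ₁ Φ₂) e H (S : (E₁ × E₂) [⋀^Fin K]→L[ℝ] ℂ))).toAddSubgroup) :
    x.compContinuousLinearMap (ContinuousLinearMap.inr ℝ E₁ E₂) ∈ integralForms Φ₂ l ⊓ ⨅ s : integralHodgeClassesIn Φ₂ k p,
        (LinearMap.ker (poincarePairing Φ₂ e₂ h₂ (s : E₂ [⋀^Fin k]→L[ℝ] ℂ))).toAddSubgroup := by
  subst hK hP
  exact compContinuousLinearMap_inr_mem_integralHodgeAnnihilator Φ₁ Φ₂ e₁ e₂ e h₂ H hg₁ p hx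

/-! ## §3 The first factor: `p₁^* T(X₁) ⊆ T(X₁ × X₂)`, `ι₁^* T(X₁ × X₂) ⊆ T(X₁)`, `p_{1*} T(X₁ × X₂) ⊆ T(X₁)` -/

/-- **`p₁^* T^l_{k,p}(X₁) ⊆ T^l_{K,P}(X₁ × X₂)` for `K = N₂ + k`, `P = g₂ + p`** (`g₂ = dim_ℂ X₂`, `N₂ = 2g₂`): `p₁^*t = s′^*(p₂′^*t)` for the
second projection `p₂′` of `X₂ × X₁`, so g33-#1 on `X₂ × X₁` and the swap (§1) give the claim.
[cite: VoisinHodgeI2002, §7.3.2 Lemma 7.28 and PDF p. 151] [cite: Huybrechts2016K3, Ch. 3 §2.2 Def. 2.5 (PDF p. 58)] -/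
theorem comp_fst_mem_integralHodgeAnnihilator (e₂ : Fin N₂ ≃ ι₂) (e₁ : Fin n₁ ≃ ι₁) (e : Fin n ≃ ι₁ ⊕ ι₂) (h₁ : k + l = n₁)
    {K P g₂ : ℕ} (hK : N₂ + k = K) (H : K + l = n) (hg₂ : finrank ℂ E₂ = g₂) {p : ℕ} (hP : g₂ + p = P)
    {t : E₁ [⋀^Fin l]→L[ℝ] ℂ}
    (ht : t ∈ integralForms Φ₁ l ⊓ ⨅ s : integralHodgeClassesIn Φ₁ k p,
        (LinearMap.ker (poincarePairing Φ₁ e₁ h₁ (s : E₁ [⋀^Fin k]→L[ℝ] ℂ))).toAddSubgroup) :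
    t.compContinuousLinearMap (ContinuousLinearMap.fst ℝ E₁ E₂) ∈
      integralForms (prodPeriod Φ₁ Φ₂) l ⊓ ⨅ S : integralHodgeClassesIn (prodPeriod Φ₁ Φ₂) K P,
        (LinearMap.ker (poincarePairing (prodPeriod Φ₁ Φ₂) e H (S : (E₁ × E₂) [⋀^Fin K]→L[ℝ] ℂ))).toAddSubgroup := by
  have h2 := comp_snd_mem_integralHodgeAnnihilator_of_eq Φ₂ Φ₁ e₂ e₁ (e.trans (Equiv.sumComm ι₁ ι₂)) h₁ hK H hg₂ hP ht
  have hfst : t.compContinuousLinearMap (ContinuousLinearMap.fst ℝ E₁ E₂) =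
      (t.compContinuousLinearMap (ContinuousLinearMap.snd ℝ E₂ E₁)).compContinuousLinearMap
        (ContinuousLinearEquiv.prodComm ℝ E₁ E₂ : E₁ × E₂ →L[ℝ] E₂ × E₁) := by
    ext v; rfl
  rw [hfst]
  exact comp_prodComm_mem_integralHodgeAnnihilator Φ₂ Φ₁ (e.trans (Equiv.sumComm ι₁ ι₂)) e H P h2

/-- **`ι₁^* T^l_{K,P}(X₁ × X₂) ⊆ T^l_{k,p}(X₁)` for `K = N₂ + k`, `P = g₂ + p`**: restriction to the fibre `X₁ × 0` of `p₂`
(`ι₁^* x = ι₂′^*(s^*x)` for the fibre inclusion `ι₂′` of `X₂ × X₁`). [cite: VoisinHodgeI2002, §7.3.2 (PDF pp. 150–151)] [cite: Arapura2012, §5.5.2 Exercise 5.5.5, p. 115] -/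
theorem compContinuousLinearMap_inl_mem_integralHodgeAnnihilator (e₂ : Fin N₂ ≃ ι₂) (e₁ : Fin n₁ ≃ ι₁) (e : Fin n ≃ ι₁ ⊕ ι₂)
    (h₁ : k + l = n₁) {K P g₂ : ℕ} (hK : N₂ + k = K) (H : K + l = n) (hg₂ : finrank ℂ E₂ = g₂) {p : ℕ} (hP : g₂ + p = P)
    {x : (E₁ × E₂) [⋀^Fin l]→L[ℝ] ℂ}
    (hx : x ∈ integralForms (prodPeriod Φ₁ Φ₂) l ⊓ ⨅ S : integralHodgeClassesIn (prodPeriod Φ₁ Φ₂) K P,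
        (LinearMap.ker (poincarePairing (prodPeriod Φ₁ Φ₂) e H (S : (E₁ × E₂) [⋀^Fin K]→L[ℝ] ℂ))).toAddSubgroup) :
    x.compContinuousLinearMap (ContinuousLinearMap.inl ℝ E₁ E₂) ∈ integralForms Φ₁ l ⊓ ⨅ s : integralHodgeClassesIn Φ₁ k p,
        (LinearMap.ker (poincarePairing Φ₁ e₁ h₁ (s : E₁ [⋀^Fin k]→L[ℝ] ℂ))).toAddSubgroup := by
  have hs := comp_prodComm_mem_integralHodgeAnnihilator Φ₁ Φ₂ e (e.trans (Equiv.sumComm ι₁ ι₂)) H P hx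
  have hinl : x.compContinuousLinearMap (ContinuousLinearMap.inl ℝ E₁ E₂) =
      (x.compContinuousLinearMap (ContinuousLinearEquiv.prodComm ℝ E₂ E₁ : E₂ × E₁ →L[ℝ] E₁ × E₂)).compContinuousLinearMap
        (ContinuousLinearMap.inr ℝ E₂ E₁) := by
    ext v; rfl
  rw [hinl]
  exact compContinuousLinearMap_inr_mem_integralHodgeAnnihilator_of_eq Φ₂ Φ₁ e₂ e₁ (e.trans (Equiv.sumComm ι₁ ι₂)) h₁ hK H hg₂ hP hs

/-- **`p_{1*} T^{N₂+l}_{k,p}(X₁ × X₂) ⊆ T^l_{k,p}(X₁)`** with `p_{1*} = p₂′_* ∘ s^*` (integration along the fibre `X₂`, read through the swap: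
`pushforwardFst Φ₂ Φ₁ e₂ (x ∘ s)`). [cite: VoisinHodgeI2002, §7.3.2 (PDF pp. 150–151)] [cite: Arapura2012, §5.5.1 Lemma 5.5.1, p. 114] -/
theorem pushforwardFst_comp_prodComm_mem_integralHodgeAnnihilator (e₂ : Fin N₂ ≃ ι₂) (e₁ : Fin n₁ ≃ ι₁) (e : Fin n ≃ ι₁ ⊕ ι₂)
    (h₁ : k + l = n₁) (H' : k + (N₂ + l) = n) (p : ℕ) {x : (E₁ × E₂) [⋀^Fin (N₂ + l)]→L[ℝ] ℂ}
    (hx : x ∈ integralForms (prodPeriod Φ₁ Φ₂) (N₂ + l) ⊓ ⨅ S : integralHodgeClassesIn (prodPeriod Φ₁ Φ₂) k p,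
        (LinearMap.ker (poincarePairing (prodPeriod Φ₁ Φ₂) e H' (S : (E₁ × E₂) [⋀^Fin k]→L[ℝ] ℂ))).toAddSubgroup) :
    pushforwardFst Φ₂ Φ₁ e₂
        (x.compContinuousLinearMap (ContinuousLinearEquiv.prodComm ℝ E₂ E₁ : E₂ × E₁ →L[ℝ] E₁ × E₂)) ∈
      integralForms Φ₁ l ⊓ ⨅ s : integralHodgeClassesIn Φ₁ k p,
        (LinearMap.ker (poincarePairing Φ₁ e₁ h₁ (s : E₁ [⋀^Fin k]→L[ℝ] ℂ))).toAddSubgroup :=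
  pushforwardFst_mem_integralHodgeAnnihilator Φ₂ Φ₁ e₂ e₁ (e.trans (Equiv.sumComm ι₁ ι₂)) h₁ H' p
    (comp_prodComm_mem_integralHodgeAnnihilator Φ₁ Φ₂ e (e.trans (Equiv.sumComm ι₁ ι₂)) H' p hx)

/-- **`p₁^*|_T : T^l_{k,p}(X₁) ↪ T^l_{K,P}(X₁ × X₂)` is a split injection of `ℤ`-modules** (retraction `ι₁^*|_T`, `ι₁^* p₁^* = id`).
[cite: VoisinHodgeI2002, §7.3.2 Lemma 7.28] [cite: HatcherAT2002, §3.2 Thm. 3.15] -/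
theorem exists_intLinearMap_integralHodgeAnnihilator_comp_fst (e₂ : Fin N₂ ≃ ι₂) (e₁ : Fin n₁ ≃ ι₁) (e : Fin n ≃ ι₁ ⊕ ι₂)
    (h₁ : k + l = n₁) {K P g₂ : ℕ} (hK : N₂ + k = K) (H : K + l = n) (hg₂ : finrank ℂ E₂ = g₂) {p : ℕ} (hP : g₂ + p = P) :
    ∃ (P₁ : ↥(integralForms Φ₁ l ⊓ ⨅ s : integralHodgeClassesIn Φ₁ k p,
          (LinearMap.ker (poincarePairing Φ₁ e₁ h₁ (s : E₁ [⋀^Fin k]→L[ℝ] ℂ))).toAddSubgroup) →ₗ[ℤ]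
        ↥(integralForms (prodPeriod Φ₁ Φ₂) l ⊓ ⨅ S : integralHodgeClassesIn (prodPeriod Φ₁ Φ₂) K P,
          (LinearMap.ker (poincarePairing (prodPeriod Φ₁ Φ₂) e H (S : (E₁ × E₂) [⋀^Fin K]→L[ℝ] ℂ))).toAddSubgroup))
      (R₁ : ↥(integralForms (prodPeriod Φ₁ Φ₂) l ⊓ ⨅ S : integralHodgeClassesIn (prodPeriod Φ₁ Φ₂) K P,
          (LinearMap.ker (poincarePairing (prodPeriod Φ₁ Φ₂) e H (S : (E₁ × E₂) [⋀^Fin K]→L[ℝ] ℂ))).toAddSubgroup) →ₗ[ℤ]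
        ↥(integralForms Φ₁ l ⊓ ⨅ s : integralHodgeClassesIn Φ₁ k p,
          (LinearMap.ker (poincarePairing Φ₁ e₁ h₁ (s : E₁ [⋀^Fin k]→L[ℝ] ℂ))).toAddSubgroup)),
      (∀ t, (P₁ t : (E₁ × E₂) [⋀^Fin l]→L[ℝ] ℂ) =
          (t : E₁ [⋀^Fin l]→L[ℝ] ℂ).compContinuousLinearMap (ContinuousLinearMap.fst ℝ E₁ E₂)) ∧
      (∀ x, (R₁ x : E₁ [⋀^Fin l]→L[ℝ] ℂ) =
          (x : (E₁ × E₂) [⋀^Fin l]→L[ℝ] ℂ).compContinuousLinearMap (ContinuousLinearMap.inl ℝ E₁ E₂)) ∧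
      R₁ ∘ₗ P₁ = LinearMap.id ∧ Injective P₁ ∧ Surjective R₁ := by
  set P₁ : ↥(integralForms Φ₁ l ⊓ ⨅ s : integralHodgeClassesIn Φ₁ k p,
          (LinearMap.ker (poincarePairing Φ₁ e₁ h₁ (s : E₁ [⋀^Fin k]→L[ℝ] ℂ))).toAddSubgroup) →ₗ[ℤ]
        ↥(integralForms (prodPeriod Φ₁ Φ₂) l ⊓ ⨅ S : integralHodgeClassesIn (prodPeriod Φ₁ Φ₂) K P,
          (LinearMap.ker (poincarePairing (prodPeriod Φ₁ Φ₂) e H (S : (E₁ × E₂) [⋀^Fin K]→L[ℝ] ℂ))).toAddSubgroup) :=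
    (AddMonoidHom.mk' (fun t ↦ ⟨(t : E₁ [⋀^Fin l]→L[ℝ] ℂ).compContinuousLinearMap (ContinuousLinearMap.fst ℝ E₁ E₂),
      comp_fst_mem_integralHodgeAnnihilator Φ₁ Φ₂ e₂ e₁ e h₁ hK H hg₂ hP t.2⟩) fun _ _ ↦ Subtype.ext (by ext v; rfl)).toIntLinearMap
    with hP₁
  set R₁ : ↥(integralForms (prodPeriod Φ₁ Φ₂) l ⊓ ⨅ S : integralHodgeClassesIn (prodPeriod Φ₁ Φ₂) K P,
          (LinearMap.ker (poincarePairing (prodPeriod Φ₁ Φ₂) e H (S : (E₁ × E₂) [⋀^Fin K]→L[ℝ] ℂ))).toAddSubgroup) →ₗ[ℤ]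
        ↥(integralForms Φ₁ l ⊓ ⨅ s : integralHodgeClassesIn Φ₁ k p,
          (LinearMap.ker (poincarePairing Φ₁ e₁ h₁ (s : E₁ [⋀^Fin k]→L[ℝ] ℂ))).toAddSubgroup) :=
    (AddMonoidHom.mk' (fun x ↦ ⟨(x : (E₁ × E₂) [⋀^Fin l]→L[ℝ] ℂ).compContinuousLinearMap (ContinuousLinearMap.inl ℝ E₁ E₂),
      compContinuousLinearMap_inl_mem_integralHodgeAnnihilator Φ₁ Φ₂ e₂ e₁ e h₁ hK H hg₂ hP x.2⟩)
      fun _ _ ↦ Subtype.ext (by ext v; rfl)).toIntLinearMap with hR₁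
  have hli : Function.LeftInverse R₁ P₁ := fun t ↦
    Subtype.ext (compContinuousLinearMap_fst_inl (E₂ := E₂) (t : E₁ [⋀^Fin l]→L[ℝ] ℂ))
  exact ⟨P₁, R₁, fun _ ↦ rfl, fun _ ↦ rfl, LinearMap.ext fun t ↦ hli t, hli.injective,
    Function.RightInverse.surjective hli⟩

/-- **`rk_ℤ T^l_{k,p}(X₁) ≤ rk_ℤ T^l_{K,P}(X₁ × X₂)`** (`K = N₂ + k`, `P = g₂ + p`): the degree-`l` transcendental lattice of the first
factor embeds into that of the product. [cite: VoisinHodgeI2002, §7.3.2 Lemma 7.28] [cite: Huybrechts2016K3, Ch. 3 §2.3 (PDF p. 59)] -/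
theorem finrank_integralHodgeAnnihilator_le_prod_left (e₂ : Fin N₂ ≃ ι₂) (e₁ : Fin n₁ ≃ ι₁) (e : Fin n ≃ ι₁ ⊕ ι₂) (h₁ : k + l = n₁)
    {K P g₂ : ℕ} (hK : N₂ + k = K) (H : K + l = n) (hg₂ : finrank ℂ E₂ = g₂) {p : ℕ} (hP : g₂ + p = P) :
    finrank ℤ ↥(integralForms Φ₁ l ⊓ ⨅ s : integralHodgeClassesIn Φ₁ k p,
        (LinearMap.ker (poincarePairing Φ₁ e₁ h₁ (s : E₁ [⋀^Fin k]→L[ℝ] ℂ))).toAddSubgroup) ≤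
      finrank ℤ ↥(integralForms (prodPeriod Φ₁ Φ₂) l ⊓ ⨅ S : integralHodgeClassesIn (prodPeriod Φ₁ Φ₂) K P,
        (LinearMap.ker (poincarePairing (prodPeriod Φ₁ Φ₂) e H (S : (E₁ × E₂) [⋀^Fin K]→L[ℝ] ℂ))).toAddSubgroup) := by
  obtain ⟨P₁, -, -, -, -, hP₁, -⟩ := exists_intLinearMap_integralHodgeAnnihilator_comp_fst Φ₁ Φ₂ e₂ e₁ e h₁ hK H hg₂ hP
  haveI := moduleFinite_integralHodgeAnnihilator (prodPeriod Φ₁ Φ₂) e H P (k := K) (l := l)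
  exact LinearMap.finrank_le_finrank_of_injective hP₁

/-! ## §4 Both factors: `p₁^* T^l(X₁) ⊕ p₂^* T^l(X₂) ↪ T^l(X₁ × X₂)` for `l ≠ 0` -/

/-- **`(t₁, t₂) ↦ p₁^*t₁ + p₂^*t₂` is an injective `ℤ`-linear map `T^l_{k₁,p₁}(X₁) × T^l_{k₂,p₂}(X₂) → T^l_{K,P}(X₁ × X₂)`** for `l ≠ 0` and
matching indices `N₂ + k₁ = K = N₁ + k₂`, `g₂ + p₁ = P = g₁ + p₂` (the `Hˡ ⊗ H⁰ ⊕ H⁰ ⊗ Hˡ` part of the Künneth decomposition is a direct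
sum inside `Hˡ(X₁ × X₂)`, g31-#4 `comp_fst_add_comp_snd_injective`). [cite: HatcherAT2002, §3.2 Thm. 3.15] [cite: VoisinHodgeI2002, §7.3.2 Lemma 7.28 and §11.3.3 Thm. 11.38] -/
theorem exists_intLinearMap_integralHodgeAnnihilator_prod_injective (hl : l ≠ 0) (e₁' : Fin N₁ ≃ ι₁) (e₂' : Fin N₂ ≃ ι₂)
    (e₁ : Fin n₁ ≃ ι₁) (e₂ : Fin n₂ ≃ ι₂) (e : Fin n ≃ ι₁ ⊕ ι₂) {k₁ k₂ : ℕ} (h₁ : k₁ + l = n₁) (h₂ : k₂ + l = n₂)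
    {K P g₁ g₂ : ℕ} (hK₁ : N₂ + k₁ = K) (hK₂ : N₁ + k₂ = K) (H : K + l = n) (hg₁ : finrank ℂ E₁ = g₁) (hg₂ : finrank ℂ E₂ = g₂)
    {p₁ p₂ : ℕ} (hP₁ : g₂ + p₁ = P) (hP₂ : g₁ + p₂ = P) :
    ∃ J : (↥(integralForms Φ₁ l ⊓ ⨅ s : integralHodgeClassesIn Φ₁ k₁ p₁,
            (LinearMap.ker (poincarePairing Φ₁ e₁ h₁ (s : E₁ [⋀^Fin k₁]→L[ℝ] ℂ))).toAddSubgroup) ×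
          ↥(integralForms Φ₂ l ⊓ ⨅ s : integralHodgeClassesIn Φ₂ k₂ p₂,
            (LinearMap.ker (poincarePairing Φ₂ e₂ h₂ (s : E₂ [⋀^Fin k₂]→L[ℝ] ℂ))).toAddSubgroup)) →ₗ[ℤ]
        ↥(integralForms (prodPeriod Φ₁ Φ₂) l ⊓ ⨅ S : integralHodgeClassesIn (prodPeriod Φ₁ Φ₂) K P,
          (LinearMap.ker (poincarePairing (prodPeriod Φ₁ Φ₂) e H (S : (E₁ × E₂) [⋀^Fin K]→L[ℝ] ℂ))).toAddSubgroup),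
      (∀ tt, (J tt : (E₁ × E₂) [⋀^Fin l]→L[ℝ] ℂ) =
          (tt.1 : E₁ [⋀^Fin l]→L[ℝ] ℂ).compContinuousLinearMap (ContinuousLinearMap.fst ℝ E₁ E₂) +
            (tt.2 : E₂ [⋀^Fin l]→L[ℝ] ℂ).compContinuousLinearMap (ContinuousLinearMap.snd ℝ E₁ E₂)) ∧ Injective J := by
  refine ⟨(AddMonoidHom.mk' (fun tt ↦ ⟨(tt.1 : E₁ [⋀^Fin l]→L[ℝ] ℂ).compContinuousLinearMap (ContinuousLinearMap.fst ℝ E₁ E₂) +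
        (tt.2 : E₂ [⋀^Fin l]→L[ℝ] ℂ).compContinuousLinearMap (ContinuousLinearMap.snd ℝ E₁ E₂),
      add_mem (comp_fst_mem_integralHodgeAnnihilator Φ₁ Φ₂ e₂' e₁ e h₁ hK₁ H hg₂ hP₁ tt.1.2)
        (comp_snd_mem_integralHodgeAnnihilator_of_eq Φ₁ Φ₂ e₁' e₂ e h₂ hK₂ H hg₁ hP₂ tt.2.2)⟩)
      fun a b ↦ Subtype.ext ?_).toIntLinearMap, fun _ ↦ rfl, fun tt tt' htt ↦ ?_⟩
  · simp only [Prod.fst_add, Prod.snd_add, AddSubgroup.coe_add]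
    ext v
    simp only [ContinuousAlternatingMap.add_apply, ContinuousAlternatingMap.compContinuousLinearMap_apply]
    ring
  · have h := congrArg (fun z : ↥(integralForms (prodPeriod Φ₁ Φ₂) l ⊓
      ⨅ S : integralHodgeClassesIn (prodPeriod Φ₁ Φ₂) K P,
        (LinearMap.ker (poincarePairing (prodPeriod Φ₁ Φ₂) e H (S : (E₁ × E₂) [⋀^Fin K]→L[ℝ] ℂ))).toAddSubgroup) ↦
          (z : (E₁ × E₂) [⋀^Fin l]→L[ℝ] ℂ)) htt
    have hinj := comp_fst_add_comp_snd_injective (E₁ := E₁) (E₂ := E₂) hl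
      (a₁ := ((tt.1 : E₁ [⋀^Fin l]→L[ℝ] ℂ), (tt.2 : E₂ [⋀^Fin l]→L[ℝ] ℂ)))
      (a₂ := ((tt'.1 : E₁ [⋀^Fin l]→L[ℝ] ℂ), (tt'.2 : E₂ [⋀^Fin l]→L[ℝ] ℂ))) h
    obtain ⟨h1, h2⟩ := Prod.mk.inj hinj
    exact Prod.ext (Subtype.ext h1) (Subtype.ext h2)

/-- **`rk_ℤ T^l_{k₁,p₁}(X₁) + rk_ℤ T^l_{k₂,p₂}(X₂) ≤ rk_ℤ T^l_{K,P}(X₁ × X₂)`** for `l ≠ 0`, `N₂ + k₁ = K = N₁ + k₂`, `g₂ + p₁ = P = g₁ + p₂`: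
the transcendental lattices of the factors sit in that of the product as the direct sum `p₁^* T(X₁) ⊕ p₂^* T(X₂)` (for two complex `2`-tori
and `l = 2`: `rk T(X₁ × X₂) ≥ rk T(X₁) + rk T(X₂)`; the Künneth LOWER bound dual to g31-#4's `rk Hdgᵖ(X₁, ℤ) + rk Hdgᵖ(X₂, ℤ) ≤ rk Hdgᵖ(X₁ × X₂, ℤ)`).
[cite: HatcherAT2002, §3.2 Thm. 3.15] [cite: VoisinHodgeI2002, §7.3.2 Lemma 7.28 and §11.3.3 Thm. 11.38] [cite: Huybrechts2016K3, Ch. 3 §2.3 (PDF p. 59)] -/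
theorem finrank_integralHodgeAnnihilator_add_le_prod (hl : l ≠ 0) (e₁' : Fin N₁ ≃ ι₁) (e₂' : Fin N₂ ≃ ι₂)
    (e₁ : Fin n₁ ≃ ι₁) (e₂ : Fin n₂ ≃ ι₂) (e : Fin n ≃ ι₁ ⊕ ι₂) {k₁ k₂ : ℕ} (h₁ : k₁ + l = n₁) (h₂ : k₂ + l = n₂)
    {K P g₁ g₂ : ℕ} (hK₁ : N₂ + k₁ = K) (hK₂ : N₁ + k₂ = K) (H : K + l = n) (hg₁ : finrank ℂ E₁ = g₁) (hg₂ : finrank ℂ E₂ = g₂)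
    {p₁ p₂ : ℕ} (hP₁ : g₂ + p₁ = P) (hP₂ : g₁ + p₂ = P) :
    finrank ℤ ↥(integralForms Φ₁ l ⊓ ⨅ s : integralHodgeClassesIn Φ₁ k₁ p₁,
          (LinearMap.ker (poincarePairing Φ₁ e₁ h₁ (s : E₁ [⋀^Fin k₁]→L[ℝ] ℂ))).toAddSubgroup) +
        finrank ℤ ↥(integralForms Φ₂ l ⊓ ⨅ s : integralHodgeClassesIn Φ₂ k₂ p₂,
          (LinearMap.ker (poincarePairing Φ₂ e₂ h₂ (s : E₂ [⋀^Fin k₂]→L[ℝ] ℂ))).toAddSubgroup) ≤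
      finrank ℤ ↥(integralForms (prodPeriod Φ₁ Φ₂) l ⊓ ⨅ S : integralHodgeClassesIn (prodPeriod Φ₁ Φ₂) K P,
        (LinearMap.ker (poincarePairing (prodPeriod Φ₁ Φ₂) e H (S : (E₁ × E₂) [⋀^Fin K]→L[ℝ] ℂ))).toAddSubgroup) := by
  obtain ⟨J, -, hJ⟩ := exists_intLinearMap_integralHodgeAnnihilator_prod_injective Φ₁ Φ₂ hl e₁' e₂' e₁ e₂ e h₁ h₂ hK₁ hK₂ H hg₁ hg₂
    hP₁ hP₂
  haveI := moduleFinite_integralHodgeAnnihilator (prodPeriod Φ₁ Φ₂) e H P (k := K) (l := l)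
  haveI := moduleFinite_integralHodgeAnnihilator Φ₁ e₁ h₁ p₁ (k := k₁) (l := l)
  haveI := moduleFinite_integralHodgeAnnihilator Φ₂ e₂ h₂ p₂ (k := k₂) (l := l)
  haveI := moduleFree_integralHodgeAnnihilator Φ₁ e₁ h₁ p₁ (k := k₁) (l := l)
  haveI := moduleFree_integralHodgeAnnihilator Φ₂ e₂ h₂ p₂ (k := k₂) (l := l)
  rw [← Module.finrank_prod]
  exact LinearMap.finrank_le_finrank_of_injective hJ

end ProductFactors

end Literature.Geometry.Kaehler.ComplexTorus
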